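import Summits.Ventures.HSemireg.WedgeHankelRecurrenceGaussMixedMoments

/-!
# Venture HSemireg — **BOUNDS FOR THE ZEROS IN TERMS OF THE RECURRENCE COEFFICIENTS**: every diagonal coefficient lies between the extreme zeros, `x_0 ≤ a_i ≤ x_t` (strictly, with the
# `2 × 2` bound `(x_t − a_i)(x_t − a_{i+1}) ≥ b_{i+1}`, as soon as `t ≥ 1`); and the GERSHGORIN bound: if `b_j ≤ c_j²` (`c_j > 0`) and `a_i + c_i + c_{i+1} ≤ M` for `i ≤ t` then
# `q_n(M) ≥ c_n q_{n−1}(M) > 0` for all `n ≤ t + 1` and every zero of `q_{t+1}` is `≤ M`; symmetrically every zero is `≥ m` when `m ≤ a_i − c_i − c_{i+1}`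

HONEST FRAMING. Part of the Lean index of the computation cell `pub-hsemireg` (seat p10 gen 44, Sunday typer «UNIFORM-IN-n»).  Real polynomials and finite sums only; no variety, no cohomology
theory, no sheaf, no Ext group and no semiregularity map is constructed here; nothing here says that HC / HC_CM / HC_AV holds; no Literature fact (unproved `Prop`) is declared or used.  Custodian
versions as in `WedgeHankelSiegelIdeal` (1/3).
SOURCES (cited).  S. Gerschgorin, *Über die Abgrenzung der Eigenwerte einer Matrix*, Izv. Akad. Nauk SSSR (1931) 749–754; M. E. H. Ismail, *Classical and Quantum Orthogonal Polynomials* (2005)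
§7.2 (bounds for the extreme zeros from the recurrence coefficients; Thm 7.2.1 and the chain-sequence criterion of Wall–Wetzel, Thm 7.2.3); E. A. van Doorn, *Representations and bounds for zeros of
orthogonal polynomials and eigenvalues of sign-symmetric tri-diagonal matrices*, J. Approx. Theory 51 (1987) 254–266; R. A. Horn, C. R. Johnson, *Matrix Analysis* (2nd ed.) Thm 6.1.1.
PROOF TYPED HERE.  `a_i h_i = Σ μ x q_i² ≤ x_t h_i` (N301 with the Favard weights of N323, `P = q_i`); the `2 × 2` bound from `P = α q_i + β q_{i+1}`: the form `α²(x_t − a_i)h_i − 2αβ h_{i+1} +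
β²(x_t − a_{i+1})h_{i+1}` is non-negative, evaluated at `(α, β) = (h_{i+1}, (x_t − a_i)h_i)` and at `(α, 1)`; the Gershgorin bound by the induction `q_{n+1}(M) − c_{n+1} q_n(M) ≥ c_n (q_n(M) − c_n
q_{n−1}(M)) ≥ 0` and the Sturm count (N294) at `ξ = M` (no sign change ⇒ no zero to the right); the lower bound by the reflection `a ↦ −a` (N325 `recurrence_reflect_spec`).
DEDUP DISCLOSURE (`rg -n -i 'gershgorin|gerschgorin|zeros_le_bound|block_bound' Summits/Ventures/HSemireg Literature`, 2026-09-03): N303 `a_mem_Icc_gaussNodes` gives `x_0 ≤ a_n ≤ x_t` for the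
MEASURE-side Gauss rule; here it is stated for the zeros of `q_{t+1}` of a bare positive recurrence, with the strict and `2 × 2` forms; N312 (Laguerre–Samuelson) is a different bound.  The Gershgorin
items are new.  The 7 names below: 0 hits tree-wide.

WHAT IS IN THE TREE.  N301 `sum_mul_node_mul_sq_le_last`, `first_mul_sum_mul_sq_le`; N323 `favard_pairing_at_zeros`, `favard_x_pairing`; N294 `sturm_count_recurrence_below_above`; N325
`recurrence_reflect_spec`, N324 `strictMono_neg_comp_rev`.
THIS FILE (namespace `Summit.Ventures.HSemireg.Wedge.HankelOuter` continued; CHAINED on N328 (import only); 0 definitions):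
* §1094 **`diag_mem_Icc_extreme_zeros`** (`x_0 ≤ a_i ≤ x_t`, `i ≤ t`), `two_by_two_form_nonneg` (the `2 × 2` form at the top zero is non-negative), **`top_zero_block_bound`** (`a_i < x_t`,
  `a_{i+1} < x_t`, `b_{i+1} ≤ (x_t − a_i)(x_t − a_{i+1})`), **`recurrence_eval_gershgorin_lower`** (`c_{n+1} q_n(M) ≤ q_{n+1}(M)` and `0 < q_n(M)`), **`zeros_le_gershgorin`** (every zero `≤ M`),
  `recurrence_eval_gershgorin_reflect` (the reflected hypotheses), **`gershgorin_le_zeros`** (every zero `≥ m`).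
CAVEATS.  Positive recurrences; the Gershgorin majorants `c_j` are taken strictly positive with `b_j ≤ c_j²` (e.g. `c_j = √b_j`).  Nothing Ext-side.  New names only.
-/

open Module Polynomial
open scoped Matrix Polynomial

namespace Summit.Ventures.HSemireg.Wedge.HankelOuter

/-! ## §1094. Bounds for the zeros from the recurrence coefficients -/

/-- **EVERY DIAGONAL COEFFICIENT LIES BETWEEN THE EXTREME ZEROS: `x_0 ≤ a_i ≤ x_t` for `i ≤ t`** (`a_i h_i = Σ_k μ_k x_k q_i(x_k)²` with the Favard weights at the zeros of `q_{t+1}`).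
[Ismail §7.2; Horn–Johnson §1.0 (a_i = e_iᵀ J e_i lies in the numerical range); this file, §1094] -/
theorem diag_mem_Icc_extreme_zeros {q : ℕ → ℝ[X]} {a b : ℕ → ℝ} (hq0 : q 0 = 1) (hq1 : q 1 = Polynomial.X - C (a 0))
    (hrec : ∀ n, q (n + 2) = (Polynomial.X - C (a (n + 1))) * q (n + 1) - C (b (n + 1)) * q n) (hb : ∀ j, 0 < b j)
    {t : ℕ} {x : Fin (t + 1) → ℝ} (hx : StrictMono x) (hxq : q (t + 1) = ∏ j, (Polynomial.X - C (x j))) {i : ℕ} (hi : i ≤ t) :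
    x 0 ≤ a i ∧ a i ≤ x (Fin.last t) := by
  obtain ⟨μ, hμ, hpair⟩ := favard_pairing_at_zeros hq0 hq1 hrec hb hx hxq
  have hxr : ∀ j, (q (t + 1)).eval (x j) = 0 := fun j => by
    rw [hxq, eval_prod]; exact Finset.prod_eq_zero (Finset.mem_univ j) (by rw [eval_sub, eval_X, eval_C, sub_self])
  have hii := favard_x_pairing hq0 hq1 hrec hxr hpair ⟨i, Nat.lt_succ_of_le hi⟩ ⟨i, Nat.lt_succ_of_le hi⟩
  simp only [if_neg (show ¬ (i + 1 = i) by omega), if_neg (show ¬ (i = i + 1) by omega), zero_add, add_zero] at hii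
  have hnorm := hpair ⟨i, Nat.lt_succ_of_le hi⟩ ⟨i, Nat.lt_succ_of_le hi⟩
  rw [if_pos rfl] at hnorm
  have hsq : ∀ k, μ k * ((q i).eval (x k) * (q i).eval (x k)) = μ k * ((q i).eval (x k)) ^ 2 := fun k => by rw [sq]
  have hsq' : ∀ k, μ k * (x k * ((q i).eval (x k) * (q i).eval (x k))) = μ k * (x k * ((q i).eval (x k)) ^ 2) := fun k => by rw [sq]
  rw [Finset.sum_congr rfl fun k _ => hsq k] at hnorm
  rw [Finset.sum_congr rfl fun k _ => hsq' k] at hii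
  have hpos : 0 < ∏ l ∈ Finset.Ico 1 (i + 1), b l := Finset.prod_pos fun l _ => hb l
  have hup := sum_mul_node_mul_sq_le_last hx (fun k => (hμ k).le) (q i)
  have hdown := first_mul_sum_mul_sq_le hx (fun k => (hμ k).le) (q i)
  rw [hii, hnorm] at hup hdown
  exact ⟨le_of_mul_le_mul_right hdown hpos, le_of_mul_le_mul_right hup hpos⟩

/-- **The `2 × 2` form at the top zero is non-negative**: with `x = x_t`, `α²(x − a_i)h_i − 2αβ h_{i+1} + β²(x − a_{i+1})h_{i+1} ≥ 0` for all `α, β` (`i + 1 ≤ t`; `h_n = b_1⋯b_n`).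
[this file, §1094] -/
theorem two_by_two_form_nonneg {q : ℕ → ℝ[X]} {a b : ℕ → ℝ} (hq0 : q 0 = 1) (hq1 : q 1 = Polynomial.X - C (a 0))
    (hrec : ∀ n, q (n + 2) = (Polynomial.X - C (a (n + 1))) * q (n + 1) - C (b (n + 1)) * q n) (hb : ∀ j, 0 < b j)
    {t : ℕ} {x : Fin (t + 1) → ℝ} (hx : StrictMono x) (hxq : q (t + 1) = ∏ j, (Polynomial.X - C (x j))) {i : ℕ} (hi : i + 1 ≤ t) (α β : ℝ) :
    0 ≤ α ^ 2 * ((x (Fin.last t) - a i) * ∏ l ∈ Finset.Ico 1 (i + 1), b l) - 2 * α * β * ∏ l ∈ Finset.Ico 1 (i + 1 + 1), b l +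
      β ^ 2 * ((x (Fin.last t) - a (i + 1)) * ∏ l ∈ Finset.Ico 1 (i + 1 + 1), b l) := by
  obtain ⟨μ, hμ, hpair⟩ := favard_pairing_at_zeros hq0 hq1 hrec hb hx hxq
  have hxr : ∀ j, (q (t + 1)).eval (x j) = 0 := fun j => by
    rw [hxq, eval_prod]; exact Finset.prod_eq_zero (Finset.mem_univ j) (by rw [eval_sub, eval_X, eval_C, sub_self])
  set I : Fin (t + 1) := ⟨i, by omega⟩ with hI
  set J : Fin (t + 1) := ⟨i + 1, by omega⟩ with hJ
  have hII := favard_x_pairing hq0 hq1 hrec hxr hpair I I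
  have hIJ := favard_x_pairing hq0 hq1 hrec hxr hpair I J
  have hJJ := favard_x_pairing hq0 hq1 hrec hxr hpair J J
  have nII := hpair I I
  have nIJ := hpair I J
  have nJJ := hpair J J
  simp only [hI, hJ, Fin.val_mk, Fin.ext_iff, if_true, if_neg (show ¬ (i + 1 = i) by omega), if_neg (show ¬ (i = i + 1) by omega),
    if_neg (show ¬ (i + 1 + 1 = i + 1) by omega), if_neg (show ¬ (i + 1 = i + 1 + 1) by omega), if_neg (show ¬ (i = i + 1 + 1) by omega), zero_add, add_zero]
    at hII hIJ hJJ nII nIJ nJJ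
  -- the test polynomial `α q_i + β q_{i+1}`
  have hP := sum_mul_node_mul_sq_le_last hx (fun k => (hμ k).le) (C α * q i + C β * q (i + 1))
  have hl : ∀ k, μ k * ((C α * q i + C β * q (i + 1)).eval (x k)) ^ 2 = α ^ 2 * (μ k * ((q i).eval (x k) * (q i).eval (x k))) +
      2 * α * β * (μ k * ((q i).eval (x k) * (q (i + 1)).eval (x k))) + β ^ 2 * (μ k * ((q (i + 1)).eval (x k) * (q (i + 1)).eval (x k))) := fun k => by
    rw [eval_add, eval_mul, eval_mul, eval_C, eval_C]; ring
  have hl' : ∀ k, μ k * (x k * ((C α * q i + C β * q (i + 1)).eval (x k)) ^ 2) = α ^ 2 * (μ k * (x k * ((q i).eval (x k) * (q i).eval (x k)))) +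
      2 * α * β * (μ k * (x k * ((q i).eval (x k) * (q (i + 1)).eval (x k)))) + β ^ 2 * (μ k * (x k * ((q (i + 1)).eval (x k) * (q (i + 1)).eval (x k)))) := fun k => by
    rw [eval_add, eval_mul, eval_mul, eval_C, eval_C]; ring
  rw [Finset.sum_congr rfl fun k _ => hl k, Finset.sum_congr rfl fun k _ => hl' k] at hP
  simp only [Finset.sum_add_distrib, ← Finset.mul_sum] at hP
  rw [hII, hIJ, hJJ, nII, nIJ, nJJ] at hP
  linarith [hP]

/-- **THE `2 × 2` BOUND AT THE TOP ZERO: for `i + 1 ≤ t`, `a_i < x_t`, `a_{i+1} < x_t` and `b_{i+1} ≤ (x_t − a_i)(x_t − a_{i+1})`** (so `x_t ≥ (a_i + a_{i+1})∕2 + √(((a_i − a_{i+1})∕2)² + b_{i+1})`,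
the top eigenvalue of the `2 × 2` principal block). [Ismail §7.2; van Doorn 1987; this file, §1094] -/
theorem top_zero_block_bound {q : ℕ → ℝ[X]} {a b : ℕ → ℝ} (hq0 : q 0 = 1) (hq1 : q 1 = Polynomial.X - C (a 0))
    (hrec : ∀ n, q (n + 2) = (Polynomial.X - C (a (n + 1))) * q (n + 1) - C (b (n + 1)) * q n) (hb : ∀ j, 0 < b j)
    {t : ℕ} {x : Fin (t + 1) → ℝ} (hx : StrictMono x) (hxq : q (t + 1) = ∏ j, (Polynomial.X - C (x j))) {i : ℕ} (hi : i + 1 ≤ t) :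
    a i < x (Fin.last t) ∧ a (i + 1) < x (Fin.last t) ∧ b (i + 1) ≤ (x (Fin.last t) - a i) * (x (Fin.last t) - a (i + 1)) := by
  have hQ := two_by_two_form_nonneg hq0 hq1 hrec hb hx hxq hi
  have hH : 0 < ∏ l ∈ Finset.Ico 1 (i + 1), b l := Finset.prod_pos fun l _ => hb l
  have hH1 : ∏ l ∈ Finset.Ico 1 (i + 1 + 1), b l = (∏ l ∈ Finset.Ico 1 (i + 1), b l) * b (i + 1) := prod_Ico_one_succ_succ b i
  have hH1pos : 0 < ∏ l ∈ Finset.Ico 1 (i + 1 + 1), b l := by rw [hH1]; exact mul_pos hH (hb _)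
  obtain ⟨h0i, h0i1⟩ : x 0 ≤ a i ∧ a i ≤ x (Fin.last t) := diag_mem_Icc_extreme_zeros hq0 hq1 hrec hb hx hxq (by omega)
  obtain ⟨-, h1i1⟩ : x 0 ≤ a (i + 1) ∧ a (i + 1) ≤ x (Fin.last t) := diag_mem_Icc_extreme_zeros hq0 hq1 hrec hb hx hxq hi
  set X := x (Fin.last t) with hX
  set H := ∏ l ∈ Finset.Ico 1 (i + 1), b l with hHdef
  set H' := ∏ l ∈ Finset.Ico 1 (i + 1 + 1), b l with hH'def
  -- strictness: at `X = a_i` the form is linear in `α` with negative slope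
  have hlt_i : a i < X := by
    refine lt_of_le_of_ne h0i1 fun heq => ?_
    have h := hQ ((X - a (i + 1)) / 2 + 1) 1
    rw [← heq, sub_self, zero_mul, mul_zero, zero_sub] at h
    linarith [hH1pos]
  have hlt_i1 : a (i + 1) < X := by
    refine lt_of_le_of_ne h1i1 fun heq => ?_
    have h := hQ H' ((X - a i) * H)
    rw [← heq, sub_self, zero_mul, mul_zero, add_zero] at h
    have hpos : 0 < (a (i + 1) - a i) * H * (H' * H') := mul_pos (mul_pos (sub_pos.2 (heq ▸ hlt_i)) hH) (mul_pos hH1pos hH1pos)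
    linarith
  refine ⟨hlt_i, hlt_i1, ?_⟩
  -- the form at `(α, β) = (H', (X − a_i) H)`
  have h := hQ H' ((X - a i) * H)
  have hfac : H' ^ 2 * ((X - a i) * H) - 2 * H' * ((X - a i) * H) * H' + ((X - a i) * H) ^ 2 * ((X - a (i + 1)) * H') =
      (X - a i) * H * H' * ((X - a i) * (X - a (i + 1)) * H - H') := by ring
  rw [hfac] at h
  have hpos : 0 < (X - a i) * H * H' := mul_pos (mul_pos (sub_pos.2 hlt_i) hH) hH1pos
  have h' : 0 ≤ (X - a i) * (X - a (i + 1)) * H - H' := (mul_nonneg_iff_of_pos_left hpos).1 h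
  rw [hH1] at h'
  nlinarith [hH, h']

/-- **GERSHGORIN LOWER BOUND FOR THE VALUES AT `M`: if `0 < c_j`, `b_j ≤ c_j²` and `a_n + c_n + c_{n+1} ≤ M` for all `n ≤ t`, then `c_{n+1} q_n(M) ≤ q_{n+1}(M)` and `0 < q_n(M)` for `n ≤ t + 1`.**
[Gerschgorin 1931 (via the recurrence); this file, §1094] -/
theorem recurrence_eval_gershgorin_lower {q : ℕ → ℝ[X]} {a b : ℕ → ℝ} (hq0 : q 0 = 1) (hq1 : q 1 = Polynomial.X - C (a 0))
    (hrec : ∀ n, q (n + 2) = (Polynomial.X - C (a (n + 1))) * q (n + 1) - C (b (n + 1)) * q n) {c : ℕ → ℝ} (hc : ∀ j, 0 < c j) (hbc : ∀ j, b j ≤ c j ^ 2)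
    {t : ℕ} {M : ℝ} (hM : ∀ n, n ≤ t → a n + c n + c (n + 1) ≤ M) :
    ∀ n, n ≤ t → c (n + 1) * (q n).eval M ≤ (q (n + 1)).eval M ∧ 0 < (q n).eval M := by
  have key : ∀ n, n ≤ t → (c (n + 1) * (q n).eval M ≤ (q (n + 1)).eval M ∧ 0 < (q n).eval M) ∧ 0 < (q (n + 1)).eval M := by
    intro n
    induction n with
    | zero =>
      intro _
      have h0 : (q 0).eval M = 1 := by rw [hq0, eval_one]
      have h1 : (q 1).eval M = M - a 0 := by rw [hq1, eval_sub, eval_X, eval_C]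
      have hM0 := hM 0 (Nat.zero_le _)
      refine ⟨⟨by rw [h0, h1]; linarith [hc 0], by rw [h0]; exact one_pos⟩, by rw [h1]; linarith [hc 0, hc 1]⟩
    | succ n ih =>
      intro hn
      obtain ⟨⟨hstep, hpos⟩, hpos1⟩ := ih (by omega)
      have hrecM : (q (n + 2)).eval M = (M - a (n + 1)) * (q (n + 1)).eval M - b (n + 1) * (q n).eval M := by
        rw [hrec n, eval_sub, eval_mul, eval_sub, eval_X, eval_C, eval_mul, eval_C]
      have hMn := hM (n + 1) hn
      -- `q_{n+2}(M) − c_{n+2} q_{n+1}(M) ≥ c_{n+1} (q_{n+1}(M) − c_{n+1} q_n(M)) ≥ 0`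
      have hstep' : c (n + 2) * (q (n + 1)).eval M ≤ (q (n + 2)).eval M := by
        rw [hrecM]
        nlinarith [hbc (n + 1), hc (n + 1), hpos, hpos1, hstep, mul_le_mul_of_nonneg_right (hbc (n + 1)) hpos.le]
      exact ⟨⟨hstep', hpos1⟩, lt_of_lt_of_le (mul_pos (hc (n + 2)) hpos1) hstep'⟩
  exact fun n hn => (key n hn).1

/-- **GERSHGORIN UPPER BOUND FOR THE ZEROS: under the same hypotheses every zero of `q_{t+1}` is `≤ M`** (no sign change in `q_0(M), …, q_{t+1}(M)`, N294). [Gerschgorin 1931; Ismail §7.2;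
van Doorn 1987; this file, §1094] -/
theorem zeros_le_gershgorin {q : ℕ → ℝ[X]} {a b : ℕ → ℝ} (hq0 : q 0 = 1) (hq1 : q 1 = Polynomial.X - C (a 0))
    (hrec : ∀ n, q (n + 2) = (Polynomial.X - C (a (n + 1))) * q (n + 1) - C (b (n + 1)) * q n) (hb : ∀ j, 0 < b j)
    {c : ℕ → ℝ} (hc : ∀ j, 0 < c j) (hbc : ∀ j, b j ≤ c j ^ 2) {t : ℕ} {M : ℝ} (hM : ∀ n, n ≤ t → a n + c n + c (n + 1) ≤ M)
    {x : Fin (t + 1) → ℝ} (hx : StrictMono x) (hxq : q (t + 1) = ∏ j, (Polynomial.X - C (x j))) (k : Fin (t + 1)) : x k ≤ M := by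
  have hv := recurrence_eval_gershgorin_lower hq0 hq1 hrec hc hbc hM
  have hpos : ∀ n, n ≤ t + 1 → 0 < (q n).eval M := by
    intro n hn
    rcases Nat.lt_or_ge n (t + 1) with h | h
    · exact (hv n (by omega)).2
    · have hnt : n = t + 1 := by omega
      subst hnt
      exact lt_of_lt_of_le (mul_pos (hc _) (hv t le_rfl).2) (hv t le_rfl).1
  have hcount := sturm_count_recurrence hq0 hq1 hrec hb (t + 1) hx hxq (ξ := M) (fun n hn => (hpos n hn).ne')
  have hzero : ((Finset.range (t + 1)).filter (fun n => (q n).eval M * (q (n + 1)).eval M < 0)).card = 0 := by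
    rw [Finset.card_eq_zero, Finset.filter_eq_empty_iff]
    intro n hn
    exact not_lt.2 (mul_pos (hpos n (by have := Finset.mem_range.1 hn; omega)) (hpos (n + 1) (by have := Finset.mem_range.1 hn; omega))).le
  rw [hzero, eq_comm, Finset.card_eq_zero, Finset.filter_eq_empty_iff] at hcount
  exact not_lt.1 (hcount (Finset.mem_univ k))

/-- **GERSHGORIN LOWER BOUND FOR THE ZEROS: if `0 < c_j`, `b_j ≤ c_j²` and `m ≤ a_n − c_n − c_{n+1}` for `n ≤ t`, then every zero of `q_{t+1}` is `≥ m`** (the reflected recurrence `(−a, b)`, N325).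
[Gerschgorin 1931; this file, §1094] -/
theorem gershgorin_le_zeros {q : ℕ → ℝ[X]} {a b : ℕ → ℝ} (hq0 : q 0 = 1) (hq1 : q 1 = Polynomial.X - C (a 0))
    (hrec : ∀ n, q (n + 2) = (Polynomial.X - C (a (n + 1))) * q (n + 1) - C (b (n + 1)) * q n) (hb : ∀ j, 0 < b j)
    {c : ℕ → ℝ} (hc : ∀ j, 0 < c j) (hbc : ∀ j, b j ≤ c j ^ 2) {t : ℕ} {m : ℝ} (hm : ∀ n, n ≤ t → m ≤ a n - c n - c (n + 1))
    {x : Fin (t + 1) → ℝ} (hx : StrictMono x) (hxq : q (t + 1) = ∏ j, (Polynomial.X - C (x j))) (k : Fin (t + 1)) : m ≤ x k := by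
  obtain ⟨h0, h1, h2, h3⟩ := recurrence_reflect_spec hq0 hq1 hrec
  have h := zeros_le_gershgorin (q := fun n => C ((-1 : ℝ) ^ n) * (q n).comp (C (-1 : ℝ)⁻¹ * Polynomial.X)) (a := fun n => -a n) h0 h1 h2 hb hc hbc
    (M := -m) (fun n hn => show -a n + c n + c (n + 1) ≤ -m by linarith [hm n hn]) (strictMono_neg_comp_rev hx) (h3 hxq) (Fin.rev k)
  simp only [Fin.rev_rev] at h
  linarith

end Summit.Ventures.HSemireg.Wedge.HankelOuter
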